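import Summits.ABC.IUTFork.Conditional.FreyLegendreAdmissibleList
import Literature.IUT.LogVolume.Corollary22PartIIUpTo
import Literature.NumberTheory.DiophantineGeometry.GenEllThm21
import Mathlib.Analysis.Real.Pi.Bounds
import HarnessLib

/-!
# THE RECORDS' SZPIRO-BAD GUARD at the Frey–Legendre point of an abc triple, decided from ONE integer inequality per `l` — LIST FORM

PROOF-ONLY file (D-0012; 0 definitions, 0 `Prop` facts, no instance, no notation) of the abc-iut cell (seat abc-iut-w6-d102, gen 5;
row «C:P6-KERNEL-N3», part 3). The window/licence certificates of branch C (`abc_of_SH_v11M_window_szpiroBadAll` p453767 and its K twin)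
bind their hypothesis only at SZPIRO-BAD `(P, l)`: the guard (VERBATIM, `P₀ ↦ P`)
`((l+5)/4 < d_mod P) ∨ (6l((l+5) − 4 d_mod P)/((l+4)(l−3))·(log-diff P + (1 − 1/l)·log 𝔣^{∤{2,l}} P) + 6l(l+5)/((l+4)(l−3))·log π
< log q^{∤{2,l}} P)`. The R-W WINDOW-TABLE's N3 universe is «the Szpiro-bad (known triple, l)» BY DESK NUMERICS; in kernel the guard
was available at two data only (`ReyssatM.szpiroBad` at (2/23⁵, 13), C-cert-3; the tier-1 K apex). Here, for an abc triple `a + b = c`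
with the factorisation list of `(abc)²` (as in `FreyLegendreAdmissibleList`), at `P = ratPoint (a/c)` (`d_mod = 1`, `log-diff = 0`,
`log 𝔣^{∤{2,l}} = Σ_{p ∣ abc, p ∉ {2,l}} log p`, `log q^{∤{2,l}} = Σ_{p ∣ abc, p ∉ {2,l}} e_p log p` — the dictionary's EXACT sums):

* `szpiroBad_triple`: the guard at a prime `l ≥ 5` follows from natural numbers `A, B, C` (`C, B > 0`) with
  `6(l²−1)/((l+4)(l−3)) ≤ A/C`, `6l(l+5)/((l+4)(l−3)) ≤ B/C` (rational checks) and ONE inequality of naturals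
  `P₁^A · 22^B ≤ P₂^C · 7^B`, `P₁ = ∏_{p ∣ abc, p ∉ {2,l}} p`, `P₂ = ∏ p^{e_p}` (using `π < 3.1416 < 22/7`, Mathlib `Real.pi_lt_d4`);
* `szpiroBad_triple_list`: the same for every `l` of a list, all side conditions ONE `decide +kernel`.

HONEST SCOPE: elementary real arithmetic (`log` monotone, `π < 22/7`) over the dictionary's closed forms; «Szpiro-bad as typed» is the
RECORDS' guard, a statement about OUR typed inequality at `(ratPoint (a/c), l)` — nothing about [IUTchIII] Cor. 3.12 or [IUTchIV]
Thm. 1.10's truth; no side taken on any author; typed ≠ proved; no abc claim.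
[cite: Mochizuki2012, IUTchIV Thm. 1.10 p. 22–23; Cor. 2.2 (ii) proof p. 44–46] [cite: MochizukiGenEll2010, Def. 3.3 p. 12]
[claim: Mochizuki2012, status: disputed] for every IUT sentence quoted.
-/

noncomputable section

open scoped Classical

namespace Summit.ABC.IUTFork.Conditional

namespace FreyAdm

open NumberField IsDedekindDomain Literature.IUT.LogVolume Literature.IUT.LogVolume.Cor22
open Literature.NumberTheory.DiophantineGeometry Literature.NumberTheory.DiophantineGeometry.GenEll
open Literature.NumberTheory.DiophantineGeometry.UniformABCConjecture Rat.HeightOneSpectrum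

variable {a b c : ℕ} {Il : List ℕ} {e : ℕ → ℕ}

/-- An odd prime of the factorisation list does not divide the numerator `2⁸(cb + a²)³` of `j(a/c)`. [folklore] -/
theorem not_dvd_numerator_of_mem_odd (h : IsABCTriple a b c) (hI : ∀ p ∈ Il, p.Prime) (hnd : Il.Nodup)
    (he : ∀ p ∈ Il, e p ≠ 0) (hD : (a * b * c) ^ 2 = (Il.map fun p => p ^ e p).prod) {p : ℕ} (hp : p ∈ Il) (hp2 : p ≠ 2) :
    ¬ p ∣ 256 * (c * b + a * a) ^ 3 := by
  have hpp : p.Prime := hI p hp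
  set v : HeightOneSpectrum (𝓞 ℚ) := (primesEquiv (R := 𝓞 ℚ)).symm ⟨p, hpp⟩ with hvdef
  have hgen : natGenerator v = p := FreyRef.natGenerator_primesEquiv_symm hpp
  have h1 := ord_jInv_of_mem_odd h hI hnd he hD v (by rw [hgen]; exact hp) (by rw [hgen]; exact hp2)
  have h2 := ord_jInv_eq h hI hnd hD v
  rw [hgen, if_pos (List.mem_toFinset.mpr hp)] at h2
  rw [hgen] at h1
  have hf : (256 * (c * b + a * a) ^ 3).factorization p = 0 := by omega
  rcases (Nat.factorization_eq_zero_iff _ _).mp hf with hnp | hnd' | h0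
  · exact absurd hpp hnp
  · exact hnd'
  · exact absurd h0 (numerator_ne_zero h)

/-- Membership in the dictionary's `{2, l}`-avoiding index set is membership in the filtered list `Il.filter (· ≠ 2 ∧ · ≠ l)`
(for a prime `l`). [folklore] -/
theorem mem_filter_avoid_iff (hI : ∀ p ∈ Il, p.Prime) {l : ℕ} (hl : l.Prime) (p : ℕ) :
    (p ∈ Il.toFinset ∧ ∀ s ∈ ({2, l} : Finset ℕ), ¬ p ∣ s) ↔ p ∈ (Il.filter (fun p => p ≠ 2 ∧ p ≠ l)).toFinset := by
  simp only [List.mem_toFinset, List.mem_filter, Finset.mem_insert, Finset.mem_singleton, forall_eq_or_imp, forall_eq,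
    decide_eq_true_eq]
  constructor
  · rintro ⟨hp, h2, hl'⟩
    exact ⟨hp, fun h => h2 (by simp [h]), fun h => hl' (by simp [h])⟩
  · rintro ⟨hp, h2, hl'⟩
    have pp := hI p hp
    exact ⟨hp, fun hd => h2 ((Nat.prime_dvd_prime_iff_eq pp Nat.prime_two).1 hd),
      fun hd => hl' ((Nat.prime_dvd_prime_iff_eq pp hl).1 hd)⟩

/-- **THE SZPIRO-BAD GUARD at `(ratPoint (a/c), l)` FROM ONE INTEGER INEQUALITY.** For an abc triple with factorisation list
`(abc)² = ∏_{p ∈ Il} p^{e_p}`, a prime `l ≥ 5`, and naturals `A, B, C` (`B, C > 0`) with `6(l²−1)/((l+4)(l−3)) ≤ A/C` and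
`6l(l+5)/((l+4)(l−3)) ≤ B/C`: if `P₁^A·22^B ≤ P₂^C·7^B` (`P₁ = ∏_{p ∈ Il, p ∉ {2,l}} p`, `P₂ = ∏_{p ∈ Il, p ∉ {2,l}} p^{e_p}`), then the
records' guard holds (right disjunct): `d_mod = 1`, `log-diff = 0`, the dictionary's exact sums, `π < 3.1416 < 22/7`.
[cite: Mochizuki2012, IUTchIV Thm. 1.10 p. 22–23] [claim: Mochizuki2012, status: disputed] -/
theorem szpiroBad_triple (h : IsABCTriple a b c) (hI : ∀ p ∈ Il, p.Prime) (hnd : Il.Nodup) (he : ∀ p ∈ Il, e p ≠ 0)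
    (hD : (a * b * c) ^ 2 = (Il.map fun p => p ^ e p).prod) {l : ℕ} (hl : l.Prime) (h5 : 5 ≤ l)
    {A B C : ℕ} (hC : 0 < C) (hB : 0 < B)
    (hA : 6 * ((l : ℚ) ^ 2 - 1) / (((l : ℚ) + 4) * ((l : ℚ) - 3)) ≤ (A : ℚ) / C)
    (hBq : 6 * (l : ℚ) * ((l : ℚ) + 5) / (((l : ℚ) + 4) * ((l : ℚ) - 3)) ≤ (B : ℚ) / C)
    (hineq : (Il.filter (fun p => p ≠ 2 ∧ p ≠ l)).prod ^ A * 22 ^ B ≤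
      ((Il.filter (fun p => p ≠ 2 ∧ p ≠ l)).map (fun p => p ^ e p)).prod ^ C * 7 ^ B) :
    ((l : ℝ) + 5) / 4 < (Cor22.dmod (ratPoint ((a : ℚ) / c)) : ℝ) ∨
        6 * l * (((l : ℝ) + 5) - 4 * Cor22.dmod (ratPoint ((a : ℚ) / c))) / (((l : ℝ) + 4) * ((l : ℝ) - 3))
            * ((ratPoint ((a : ℚ) / c)).logDiff + (1 - 1 / (l : ℝ)) * Cor22.logCondAvoid (ratPoint ((a : ℚ) / c)) {2, l})
          + 6 * l * ((l : ℝ) + 5) / (((l : ℝ) + 4) * ((l : ℝ) - 3)) * Real.log Real.pi <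
          Cor22.logQAvoid (ratPoint ((a : ℚ) / c)) {2, l} := by
  right
  -- degree-one bookkeeping
  have hdmod : Cor22.dmod (ratPoint ((a : ℚ) / c)) = 1 := dmod_eq_one_of_degree_le_one (degree_ratPoint _).le
  have hdiff : (ratPoint ((a : ℚ) / c)).logDiff = 0 := logDiff_ratPoint _
  -- the dictionary's exact sums
  have hI' : ∀ p ∈ Il.toFinset, p.Prime := fun p hp => hI p (List.mem_toFinset.mp hp)
  have he' : ∀ p ∈ Il.toFinset, e p ≠ 0 := fun p hp => he p (List.mem_toFinset.mp hp)
  have hcop : ∀ p ∈ Il.toFinset, (∀ s ∈ ({2, l} : Finset ℕ), ¬ p ∣ s) → ¬ p ∣ 256 * (c * b + a * a) ^ 3 := by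
    intro p hp hs
    have hp2 : p ≠ 2 := fun h2 => hs 2 (by simp) (by simp [h2])
    exact not_dvd_numerator_of_mem_odd h hI hnd he hD (List.mem_toFinset.mp hp) hp2
  have hLC := logCondAvoid_ratPoint_eq_sum hI' he' (prod_toFinset_eq hnd hD) (jInv_ratPoint_triple h) (numerator_ne_zero h)
    {2, l} hcop
  have hLQ := logQAvoid_ratPoint_eq_sum hI' he' (prod_toFinset_eq hnd hD) (jInv_ratPoint_triple h) (numerator_ne_zero h)
    {2, l} hcop
  set Tl := Il.filter (fun p => p ≠ 2 ∧ p ≠ l) with hTl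
  have hndT : Tl.Nodup := hnd.filter _
  have hTpos : ∀ p ∈ Tl, 0 < p := fun p hp => (hI p (List.mem_filter.mp hp).1).pos
  have hLC' : logCondAvoid (ratPoint ((a : ℚ) / c)) {2, l} = ∑ p ∈ Tl.toFinset, Real.log (p : ℝ) := by
    rw [hLC]
    exact Finset.sum_congr (by ext p; rw [Finset.mem_filter]; exact mem_filter_avoid_iff hI hl p) (fun _ _ => rfl)
  have hLQ' : logQAvoid (ratPoint ((a : ℚ) / c)) {2, l} = ∑ p ∈ Tl.toFinset, (e p : ℝ) * Real.log (p : ℝ) := by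
    rw [hLQ]
    exact Finset.sum_congr (by ext p; rw [Finset.mem_filter]; exact mem_filter_avoid_iff hI hl p) (fun _ _ => rfl)
  -- the two sums as logs of natural numbers
  have hX : ∑ p ∈ Tl.toFinset, Real.log (p : ℝ) = Real.log ((Tl.prod : ℕ) : ℝ) := by
    rw [Nat.cast_list_prod, ← List.prod_toFinset _ hndT, Real.log_prod]
    intro p hp
    exact_mod_cast (hTpos p (List.mem_toFinset.mp hp)).ne'
  have hY : ∑ p ∈ Tl.toFinset, (e p : ℝ) * Real.log (p : ℝ) = Real.log (((Tl.map fun p => p ^ e p).prod : ℕ) : ℝ) := by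
    rw [Nat.cast_list_prod, List.map_map, ← List.prod_toFinset _ hndT, Real.log_prod]
    · refine Finset.sum_congr rfl fun p _ => ?_
      simp only [Function.comp_apply, Nat.cast_pow, Real.log_pow]
    · intro p hp
      simp only [Function.comp_apply, Nat.cast_pow]
      exact pow_ne_zero _ (by exact_mod_cast (hTpos p (List.mem_toFinset.mp hp)).ne')
  rw [hdmod, hdiff, hLC', hLQ', hX, hY]
  -- abbreviations
  set X := Real.log ((Tl.prod : ℕ) : ℝ) with hXdef
  set Y := Real.log (((Tl.map fun p => p ^ e p).prod : ℕ) : ℝ) with hYdef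
  have hP1pos : 0 < Tl.prod := List.prod_pos fun p hp => hTpos p hp
  have hP2pos : 0 < (Tl.map fun p => p ^ e p).prod :=
    List.prod_pos fun x hx => by
      obtain ⟨p, hp, rfl⟩ := List.mem_map.mp hx
      exact pow_pos (hTpos p hp) _
  have hP1r : (0 : ℝ) < ((Tl.prod : ℕ) : ℝ) := by exact_mod_cast hP1pos
  have hP2r : (0 : ℝ) < (((Tl.map fun p => p ^ e p).prod : ℕ) : ℝ) := by exact_mod_cast hP2pos
  have hX0 : 0 ≤ X := Real.log_nonneg (by exact_mod_cast hP1pos)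
  -- π < 22/7
  have hpi : Real.log Real.pi < Real.log 22 - Real.log 7 := by
    rw [← Real.log_div (by norm_num) (by norm_num)]
    exact Real.log_lt_log Real.pi_pos (lt_trans Real.pi_lt_d4 (by norm_num))
  have hpi0 : 0 < Real.log Real.pi := Real.log_pos (by linarith [Real.pi_gt_three])
  -- the integer inequality, in logs
  have hmain : (A : ℝ) * X + B * (Real.log 22 - Real.log 7) ≤ C * Y := by
    have h1 : ((Tl.prod : ℕ) : ℝ) ^ A * (22 : ℝ) ^ B ≤ (((Tl.map fun p => p ^ e p).prod : ℕ) : ℝ) ^ C * (7 : ℝ) ^ B := by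
      exact_mod_cast hineq
    have h2 := Real.log_le_log (by positivity) h1
    rw [Real.log_mul (by positivity) (by positivity), Real.log_mul (by positivity) (by positivity),
      Real.log_pow, Real.log_pow, Real.log_pow, Real.log_pow] at h2
    linarith
  -- the coefficients
  have hl5 : (5 : ℝ) ≤ l := by exact_mod_cast h5
  have hden : 0 < ((l : ℝ) + 4) * ((l : ℝ) - 3) := by nlinarith
  have hl0 : (l : ℝ) ≠ 0 := by linarith
  have hCr : (0 : ℝ) < C := by exact_mod_cast hC
  have hBr : (0 : ℝ) < B := by exact_mod_cast hB
  have hA' : 6 * ((l : ℝ) ^ 2 - 1) / (((l : ℝ) + 4) * ((l : ℝ) - 3)) ≤ (A : ℝ) / C := by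
    have := (Rat.cast_le (K := ℝ)).mpr hA
    push_cast at this
    exact this
  have hB' : 6 * (l : ℝ) * ((l : ℝ) + 5) / (((l : ℝ) + 4) * ((l : ℝ) - 3)) ≤ (B : ℝ) / C := by
    have := (Rat.cast_le (K := ℝ)).mpr hBq
    push_cast at this
    exact this
  have e1 : 6 * (l : ℝ) * (((l : ℝ) + 5) - 4 * ((1 : ℕ) : ℝ)) / (((l : ℝ) + 4) * ((l : ℝ) - 3)) * (0 + (1 - 1 / (l : ℝ)) * X) =
      (6 * ((l : ℝ) ^ 2 - 1) / (((l : ℝ) + 4) * ((l : ℝ) - 3))) * X := by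
    field_simp
    ring
  have s1 : (6 * ((l : ℝ) ^ 2 - 1) / (((l : ℝ) + 4) * ((l : ℝ) - 3))) * X ≤ (A : ℝ) / C * X :=
    mul_le_mul_of_nonneg_right hA' hX0
  have s2 : 6 * (l : ℝ) * ((l : ℝ) + 5) / (((l : ℝ) + 4) * ((l : ℝ) - 3)) * Real.log Real.pi ≤ (B : ℝ) / C * Real.log Real.pi :=
    mul_le_mul_of_nonneg_right hB' hpi0.le
  have s3 : (B : ℝ) / C * Real.log Real.pi < (B : ℝ) / C * (Real.log 22 - Real.log 7) :=
    mul_lt_mul_of_pos_left hpi (div_pos hBr hCr)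
  have s4 : (A : ℝ) / C * X + (B : ℝ) / C * (Real.log 22 - Real.log 7) ≤ Y := by
    rw [div_mul_eq_mul_div, div_mul_eq_mul_div, ← add_div, div_le_iff₀ hCr]
    linarith
  linarith [e1, s1, s2, s3, s4]

/-- **THE SZPIRO-BAD GUARD at `(ratPoint (a/c), l)` for EVERY `l` OF A LIST**, with per-`l` certificate naturals `A l, B l, C l`; the whole
side-condition block (primality, `l ≥ 5`, positivity, the two rational coefficient checks, the integer inequality) is ONE `decide +kernel`
at a datum. [cite: Mochizuki2012, IUTchIV Thm. 1.10 p. 22–23] [claim: Mochizuki2012, status: disputed] -/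
theorem szpiroBad_triple_list (h : IsABCTriple a b c) (hI : ∀ p ∈ Il, p.Prime) (hnd : Il.Nodup) (he : ∀ p ∈ Il, e p ≠ 0)
    (hD : (a * b * c) ^ 2 = (Il.map fun p => p ^ e p).prod) (A B C : ℕ → ℕ) (L : List ℕ)
    (hside : ∀ l ∈ L, l.Prime ∧ 5 ≤ l ∧ 0 < C l ∧ 0 < B l ∧
      6 * ((l : ℚ) ^ 2 - 1) / (((l : ℚ) + 4) * ((l : ℚ) - 3)) ≤ (A l : ℚ) / C l ∧
      6 * (l : ℚ) * ((l : ℚ) + 5) / (((l : ℚ) + 4) * ((l : ℚ) - 3)) ≤ (B l : ℚ) / C l ∧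
      (Il.filter (fun p => p ≠ 2 ∧ p ≠ l)).prod ^ A l * 22 ^ B l ≤
        ((Il.filter (fun p => p ≠ 2 ∧ p ≠ l)).map (fun p => p ^ e p)).prod ^ C l * 7 ^ B l) :
    ∀ l ∈ L, ((l : ℝ) + 5) / 4 < (Cor22.dmod (ratPoint ((a : ℚ) / c)) : ℝ) ∨
        6 * l * (((l : ℝ) + 5) - 4 * Cor22.dmod (ratPoint ((a : ℚ) / c))) / (((l : ℝ) + 4) * ((l : ℝ) - 3))
            * ((ratPoint ((a : ℚ) / c)).logDiff + (1 - 1 / (l : ℝ)) * Cor22.logCondAvoid (ratPoint ((a : ℚ) / c)) {2, l})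
          + 6 * l * ((l : ℝ) + 5) / (((l : ℝ) + 4) * ((l : ℝ) - 3)) * Real.log Real.pi <
          Cor22.logQAvoid (ratPoint ((a : ℚ) / c)) {2, l} := by
  intro l hl
  obtain ⟨hlp, h5, hC, hB, hA, hBq, hineq⟩ := hside l hl
  exact szpiroBad_triple h hI hnd he hD hlp h5 hC hB hA hBq hineq

end FreyAdm

end Summit.ABC.IUTFork.Conditional

end
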